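import Mathlib
import HarnessLib
import Summits.HubbardSuperconductivity.HubbardSuperconductivity.Theorems.KLProgrammeDefs
import Summits.HubbardSuperconductivity.HubbardSuperconductivity.Theorems.KLProgrammeCountPairsOffsetNondeg

/-!
# Route `KLProgramme` — support item `CountPairsOffset` (stmt-HubbardSuperconductivity-20036):
# the non-degeneracy lemmas for the offset level function, and the small constants

The four generic non-degeneracy lemmas of `KLProgrammeCountPairsOffsetNondeg.lean` (stated for an arbitrary momentum sum
`(S_x, S_y)`) specialised to the offset level function `h_P` (`coverP`, `odd_transversalP`, `even_keyP`, `diag_stratP`), and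
the choice of the small constants `τ, λ, η₀, η₁` satisfying the four smallness conditions of the offset count
(`exists_small_constants_offset`: the tree's `exists_small_constants` with the Cooper bullet re-derived for the
`η_o`-free condition of `odd_transversal_offset`).
References: G. Benfatto, A. Giuliani, V. Mastropietro, Ann. Henri Poincaré 7 (2006) 809–898, Lemma 3.1, (2.76), (2.80),
App. A2; Ann. Henri Poincaré 4 (2003) 137–193, §7. Mathematics: HOME/prover-p4/COUNTING-NOTE.md (cell gate-hubbard-kl).
-/

noncomputable section

namespace Summit.HubbardSuperconductivity.HubbardSuperconductivity.Theorems.CountPairsOffset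

set_option linter.dupNamespace false -- summit = problem name (single-conjunct summit), D-0017

open Real Set
open Literature.MathematicalPhysics.QuantumLattice Literature.MathematicalPhysics.QuantumLattice.BandSectorCounting

section Nondeg

variable {a b : ℝ} (B : BandBounds a b) {μ : ℝ} (hμ : μ ∈ Icc a b)
include hμ

/-- The covering lemma for the offset level function: if `|h_P| ≤ η₀` and both partial derivatives are `≤ λ` in modulus
then `θ₃ ≡ θ₂` modulo `π` up to `τ`. -/
theorem coverP {P : ℝ × ℝ} {θ₂ θ₃ η₀ lam τ : ℝ} (hlo : a ≤ μ - η₀) (hhi : μ + η₀ ≤ b)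
    (hh : |hfunP μ P θ₂ θ₃| ≤ η₀) (hd2 : |h3P μ P θ₃ θ₂| ≤ lam) (hd3 : |h3P μ P θ₂ θ₃| ≤ lam)
    (hsmall : 2 * (B.Cg * (lam / 2 + 2 * B.smax * (η₀ / B.Dtmin))) ≤ τ) :
    ∃ j : ℤ, |θ₃ - θ₂ - j * π| ≤ τ := by
  have hh' : |eps2 (SXP μ P θ₂ θ₃) (SYP μ P θ₂ θ₃) - μ| ≤ η₀ := by unfold hfunP at hh; exact hh
  have e3 : |Real.sin (SXP μ P θ₂ θ₃) * bandVX μ θ₃ + Real.sin (SYP μ P θ₂ θ₃) * bandVY μ θ₃| ≤ lam / 2 := by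
    unfold h3P at hd3
    rw [show 2 * Real.sin (SXP μ P θ₂ θ₃) * bandVX μ θ₃ + 2 * Real.sin (SYP μ P θ₂ θ₃) * bandVY μ θ₃ =
      2 * (Real.sin (SXP μ P θ₂ θ₃) * bandVX μ θ₃ + Real.sin (SYP μ P θ₂ θ₃) * bandVY μ θ₃) by ring,
      abs_mul, abs_two] at hd3
    linarith
  have e2 : |Real.sin (SXP μ P θ₂ θ₃) * bandVX μ θ₂ + Real.sin (SYP μ P θ₂ θ₃) * bandVY μ θ₂| ≤ lam / 2 := by
    unfold h3P at hd2
    rw [← SXP_swap, ← SYP_swap, show 2 * Real.sin (SXP μ P θ₂ θ₃) * bandVX μ θ₂ + 2 * Real.sin (SYP μ P θ₂ θ₃) * bandVY μ θ₂ =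
      2 * (Real.sin (SXP μ P θ₂ θ₃) * bandVX μ θ₂ + Real.sin (SYP μ P θ₂ θ₃) * bandVY μ θ₂) by ring,
      abs_mul, abs_two] at hd2
    linarith
  exact cover_offset B hμ hlo hhi hh' e2 e3 hsmall

/-- **Cooper-range transversality for the offset level function**: for `|c - π| ≤ τ`, if `|h_P(θ₂, θ₂ + c)| ≤ η₀` and
`|∂₂ h_P(θ₂, θ₂ + c)| ≤ λ` then `|d/dθ₂ h_P(θ₂, θ₂ + c)| ≥ h_min |c - π|`, for every offset `P`. -/
theorem odd_transversalP {P : ℝ × ℝ} {θ₂ c τ η₀ lam : ℝ} (hlo : a ≤ μ - η₀) (hhi : μ + η₀ ≤ b)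
    (hh : |hfunP μ P θ₂ (θ₂ + c)| ≤ η₀) (hd2 : |h3P μ P (θ₂ + c) θ₂| ≤ lam) (hc : |c - π| ≤ τ)
    (hsmall : 4 * B.A2 * (η₀ / B.Dtmin + B.smax * (B.Cg * (lam / 2 + 2 * B.smax * (η₀ / B.Dtmin)) + τ)) ≤ B.hmin) :
    B.hmin * |c - π| ≤ |2 * Real.sin (SXP μ P θ₂ (θ₂ + c)) * (bandVX μ θ₂ + bandVX μ (θ₂ + c)) +
        2 * Real.sin (SYP μ P θ₂ (θ₂ + c)) * (bandVY μ θ₂ + bandVY μ (θ₂ + c))| := by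
  have hh' : |eps2 (SXP μ P θ₂ (θ₂ + c)) (SYP μ P θ₂ (θ₂ + c)) - μ| ≤ η₀ := by unfold hfunP at hh; exact hh
  have e2 : |Real.sin (SXP μ P θ₂ (θ₂ + c)) * bandVX μ θ₂ + Real.sin (SYP μ P θ₂ (θ₂ + c)) * bandVY μ θ₂| ≤ lam / 2 := by
    unfold h3P at hd2
    rw [← SXP_swap, ← SYP_swap,
      show 2 * Real.sin (SXP μ P θ₂ (θ₂ + c)) * bandVX μ θ₂ + 2 * Real.sin (SYP μ P θ₂ (θ₂ + c)) * bandVY μ θ₂ =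
        2 * (Real.sin (SXP μ P θ₂ (θ₂ + c)) * bandVX μ θ₂ + Real.sin (SYP μ P θ₂ (θ₂ + c)) * bandVY μ θ₂) by ring,
      abs_mul, abs_two] at hd2
    linarith
  exact odd_transversal_offset B hμ hlo hhi hh' e2 hc hsmall


/-- The fold key bound for the offset level function (the tree's `even_key` with `P` for `p(θ₁)`). -/
theorem even_keyP {P : ℝ × ℝ} {σ t τ η₀ lam : ℝ} (ht0 : 0 < t) (htτ : t ≤ τ) (hlo : a ≤ μ - η₀) (hhi : μ + η₀ ≤ b)
    (hh : |hfunP μ P (σ - t / 2) (σ + t / 2)| ≤ η₀) (hG : |GfunP μ P σ t| ≤ 4 * lam)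
    (hsmall : 2 * B.A2 * (η₀ / B.Dtmin + B.smax * (B.Cg * (lam + B.A2 * τ + 2 * B.smax * (η₀ / B.Dtmin)) + τ / 2)) ≤ B.hmin / 2) :
    B.hmin / 2 * t ≤ |Real.sin (SXP μ P (σ - t / 2) (σ + t / 2)) * (bandVX μ (σ + t / 2) - bandVX μ (σ - t / 2)) +
        Real.sin (SYP μ P (σ - t / 2) (σ + t / 2)) * (bandVY μ (σ + t / 2) - bandVY μ (σ - t / 2))| := by
  have hh' : |eps2 (SXP μ P (σ - t / 2) (σ + t / 2)) (SYP μ P (σ - t / 2) (σ + t / 2)) - μ| ≤ η₀ := by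
    unfold hfunP at hh; exact hh
  unfold GfunP at hG
  exact even_key_offset B hμ ht0 htτ hlo hhi hh' hG hsmall

/-- The stratified diagonal bound for the offset level function (the tree's `diag_strat` with `P` for `p(θ₁)`). -/
theorem diag_stratP {P : ℝ × ℝ} {σ η₀ η₁ : ℝ} (hlo : a ≤ μ - η₀) (hhi : μ + η₀ ≤ b)
    (hH : |hfunP μ P σ σ| ≤ η₀)
    (hH' : |4 * (Real.sin (SXP μ P σ σ) * bandVX μ σ + Real.sin (SYP μ P σ σ) * bandVY μ σ)| ≤ η₁)
    (hsmall : (16 * B.smax ^ 2 + 8 * B.A2) * (η₀ / B.Dtmin + B.smax * (B.Cg * (η₁ / 4 + 2 * B.smax * (η₀ / B.Dtmin)))) ≤ 2 * B.hmin) :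
    2 * B.hmin ≤ 8 * (Real.cos (SXP μ P σ σ) * bandVX μ σ ^ 2 + Real.cos (SYP μ P σ σ) * bandVY μ σ ^ 2) +
      4 * (Real.sin (SXP μ P σ σ) * bandAX μ σ + Real.sin (SYP μ P σ σ) * bandAY μ σ) := by
  have hh' : |eps2 (SXP μ P σ σ) (SYP μ P σ σ) - μ| ≤ η₀ := by unfold hfunP at hH; exact hH
  exact diag_strat_offset B hμ hlo hhi hh' hH' hsmall

end Nondeg

/-! ## The small constants -/

section Constants

/-- **Choice of the small constants for the offset count**: given the uniform bounds `B` and a margin `m₀ > 0` there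
are `τ, λ, η₀, η₁ > 0` with `η₀ ≤ m₀`, `τ < π`, satisfying the four smallness conditions of `count_pairs_offset_exists`
(covering, Cooper range for an arbitrary offset, fold, diagonal). The tree's `exists_small_constants` with the Cooper
bullet re-derived for the new (η_o-free) condition; same `τ, λ, η₀, η₁`. -/
theorem exists_small_constants_offset {a b : ℝ} (B : BandBounds a b) {m₀ : ℝ} (hm₀ : 0 < m₀) :
    ∃ τ lam η₀ η₁ : ℝ, 0 < τ ∧ τ < π ∧ 0 < lam ∧ 0 < η₀ ∧ η₀ ≤ m₀ ∧ 0 < η₁ ∧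
      2 * (B.Cg * (lam / 2 + 2 * B.smax * (η₀ / B.Dtmin))) ≤ τ ∧
      4 * B.A2 * (η₀ / B.Dtmin + B.smax * (B.Cg * (lam + 2 * B.smax * (η₀ / B.Dtmin)) + τ)) ≤ B.hmin ∧
      2 * B.A2 * (η₀ / B.Dtmin + B.smax * (B.Cg * (lam + B.A2 * τ + 2 * B.smax * (η₀ / B.Dtmin)) + τ / 2)) ≤ B.hmin / 2 ∧
      (16 * B.smax ^ 2 + 8 * B.A2) * (η₀ / B.Dtmin + B.smax * (B.Cg * (η₁ / 4 + 2 * B.smax * (η₀ / B.Dtmin)))) ≤ 2 * B.hmin := by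
  have hA := B.A2_pos; have hs := B.smax_pos; have hh := B.hmin_pos; have hCg := B.Cg_pos; have hDt := B.Dtmin_pos
  have hπ := Real.pi_pos
  set A := B.A2; set s := B.smax; set h := B.hmin; set Cg := B.Cg; set Dt := B.Dtmin
  -- τ
  set τ := min (1 / 2) (min (h / (16 * A * s * (1 + Cg * s ^ 2))) (h / (16 * A * s * (Cg * A + 1)))) with hτ
  have hτ0 : 0 < τ := lt_min (by norm_num) (lt_min (by positivity) (by positivity))
  have hτ1 : τ ≤ 1 / 2 := min_le_left _ _
  have hτa : τ ≤ h / (16 * A * s * (1 + Cg * s ^ 2)) := (min_le_right _ _).trans (min_le_left _ _)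
  have hτb : τ ≤ h / (16 * A * s * (Cg * A + 1)) := (min_le_right _ _).trans (min_le_right _ _)
  -- λ, η₁
  set lam := min (τ / (2 * Cg)) (h / (16 * A * s * Cg)) with hlam
  have hlam0 : 0 < lam := lt_min (by positivity) (by positivity)
  have hlam1 : lam ≤ τ / (2 * Cg) := min_le_left _ _
  have hlam2 : lam ≤ h / (16 * A * s * Cg) := min_le_right _ _
  set η₁ := 4 * h / ((16 * s ^ 2 + 8 * A) * s * Cg) with hη₁
  have hη₁0 : 0 < η₁ := by positivity
  -- η₀
  set η₀ := min m₀ (min (τ * Dt / (8 * Cg * s)) (min (h * Dt / (16 * A * (1 + 2 * s ^ 2 * Cg)))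
    (h * Dt / ((16 * s ^ 2 + 8 * A) * (1 + 2 * s ^ 2 * Cg))))) with hη₀
  have hη₀0 : 0 < η₀ := lt_min hm₀ (lt_min (by positivity) (lt_min (by positivity) (by positivity)))
  have hη₀m : η₀ ≤ m₀ := min_le_left _ _
  have hη₀a : η₀ ≤ τ * Dt / (8 * Cg * s) := (min_le_right _ _).trans (min_le_left _ _)
  have hη₀b : η₀ ≤ h * Dt / (16 * A * (1 + 2 * s ^ 2 * Cg)) :=
    (min_le_right _ _).trans ((min_le_right _ _).trans (min_le_left _ _))
  have hη₀c : η₀ ≤ h * Dt / ((16 * s ^ 2 + 8 * A) * (1 + 2 * s ^ 2 * Cg)) :=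
    (min_le_right _ _).trans ((min_le_right _ _).trans (min_le_right _ _))
  refine ⟨τ, lam, η₀, η₁, hτ0, by linarith [Real.pi_gt_three], hlam0, hη₀0, hη₀m, hη₁0, ?_, ?_, ?_, ?_⟩
  · -- covering
    have e1 : Cg * lam ≤ τ / 2 := by
      calc Cg * lam ≤ Cg * (τ / (2 * Cg)) := mul_le_mul_of_nonneg_left hlam1 hCg.le
        _ = τ / 2 := by field_simp
    have e2 : 4 * Cg * s * η₀ / Dt ≤ τ / 2 := by
      calc 4 * Cg * s * η₀ / Dt ≤ 4 * Cg * s * (τ * Dt / (8 * Cg * s)) / Dt := by gcongr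
        _ = τ / 2 := by field_simp; ring
    have : 2 * (Cg * (lam / 2 + 2 * s * (η₀ / Dt))) = Cg * lam + 4 * Cg * s * η₀ / Dt := by ring
    rw [this]; linarith
  · -- Cooper range, arbitrary offset
    have e1 : 4 * A * (1 + 2 * s ^ 2 * Cg) * η₀ / Dt ≤ h / 4 := by
      calc 4 * A * (1 + 2 * s ^ 2 * Cg) * η₀ / Dt ≤ 4 * A * (1 + 2 * s ^ 2 * Cg) * (h * Dt / (16 * A * (1 + 2 * s ^ 2 * Cg))) / Dt := by
            gcongr
        _ = h / 4 := by field_simp; ring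
    have e2 : 4 * A * s * Cg * lam ≤ h / 4 := by
      calc 4 * A * s * Cg * lam ≤ 4 * A * s * Cg * (h / (16 * A * s * Cg)) := mul_le_mul_of_nonneg_left hlam2 (by positivity)
        _ = h / 4 := by field_simp; ring
    have e3 : 4 * A * s * τ ≤ h / 4 := by
      calc 4 * A * s * τ ≤ 4 * A * s * (h / (16 * A * s * (1 + Cg * s ^ 2))) := mul_le_mul_of_nonneg_left hτa (by positivity)
        _ = h / (4 * (1 + Cg * s ^ 2)) := by field_simp; ring
        _ ≤ h / 4 := by
            apply div_le_div_of_nonneg_left hh.le (by norm_num)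
            nlinarith [hCg, hs]
    have : 4 * A * (η₀ / Dt + s * (Cg * (lam + 2 * s * (η₀ / Dt)) + τ)) =
        4 * A * (1 + 2 * s ^ 2 * Cg) * η₀ / Dt + 4 * A * s * Cg * lam + 4 * A * s * τ := by ring
    rw [this]; linarith
  · -- fold
    have e1 : 2 * A * (1 + 2 * s ^ 2 * Cg) * η₀ / Dt ≤ h / 8 := by
      calc 2 * A * (1 + 2 * s ^ 2 * Cg) * η₀ / Dt ≤ 2 * A * (1 + 2 * s ^ 2 * Cg) * (h * Dt / (16 * A * (1 + 2 * s ^ 2 * Cg))) / Dt := by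
            gcongr
        _ = h / 8 := by field_simp; ring
    have e2 : 2 * A * s * Cg * lam ≤ h / 8 := by
      calc 2 * A * s * Cg * lam ≤ 2 * A * s * Cg * (h / (16 * A * s * Cg)) := mul_le_mul_of_nonneg_left hlam2 (by positivity)
        _ = h / 8 := by field_simp; ring
    have e3 : A * s * (2 * Cg * A + 1) * τ ≤ h / 8 := by
      calc A * s * (2 * Cg * A + 1) * τ ≤ A * s * (2 * Cg * A + 1) * (h / (16 * A * s * (Cg * A + 1))) :=
            mul_le_mul_of_nonneg_left hτb (by positivity)
        _ = h * (2 * Cg * A + 1) / (16 * (Cg * A + 1)) := by field_simp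
        _ ≤ h * (2 * (Cg * A + 1)) / (16 * (Cg * A + 1)) := by gcongr; linarith
        _ = h / 8 := by field_simp; ring
    have : 2 * A * (η₀ / Dt + s * (Cg * (lam + A * τ + 2 * s * (η₀ / Dt)) + τ / 2)) =
        2 * A * (1 + 2 * s ^ 2 * Cg) * η₀ / Dt + 2 * A * s * Cg * lam + A * s * (2 * Cg * A + 1) * τ := by ring
    rw [this]; linarith
  · -- diagonal
    have e1 : (16 * s ^ 2 + 8 * A) * (1 + 2 * s ^ 2 * Cg) * η₀ / Dt ≤ h := by
      calc (16 * s ^ 2 + 8 * A) * (1 + 2 * s ^ 2 * Cg) * η₀ / Dt ≤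
          (16 * s ^ 2 + 8 * A) * (1 + 2 * s ^ 2 * Cg) * (h * Dt / ((16 * s ^ 2 + 8 * A) * (1 + 2 * s ^ 2 * Cg))) / Dt := by gcongr
        _ = h := by field_simp
    have e2 : (16 * s ^ 2 + 8 * A) * s * Cg * η₁ / 4 = h := by rw [hη₁]; field_simp
    have : (16 * s ^ 2 + 8 * A) * (η₀ / Dt + s * (Cg * (η₁ / 4 + 2 * s * (η₀ / Dt)))) =
        (16 * s ^ 2 + 8 * A) * (1 + 2 * s ^ 2 * Cg) * η₀ / Dt + (16 * s ^ 2 + 8 * A) * s * Cg * η₁ / 4 := by ring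
    rw [this]; linarith

end Constants

end Summit.HubbardSuperconductivity.HubbardSuperconductivity.Theorems.CountPairsOffset

end
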